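import Summits.QuantumFields.BalabanUV.Beta.FP.TorusCompositeCompanionFamilyG
import Summits.QuantumFields.BalabanUV.Beta.FP.KernelPeriodisationFibLoc

/-!
# `BalabanUV.Beta.FP.TorusCompanionSumPeriodic` — road «FP» for binder row D1, ROUTE T (β1), J-RISK-3′ «THE PACKING AT THE PASS», SPEC-48 (B3):
# **leaf-06's COMPANION SUM, STOREY BY STOREY PERIODISED: IF EVERY STOREY's CONJUGATE IS A PERIODISED KERNEL ON THE FINEST TORUS, THE WHOLE
# `compSumSym` IS THE SUM OF THOSE PERIODISATIONS — AND THE PERIODISATION OF THE SUM OF THE KERNELS**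

WHY.  The END wrapper's pin `hH₁f` carries leaf-05's `compSumSym Lc (onTowerFamily Lc M F) M lev rs (n+1)`: by leaf-06's PUSH-INSIDE recursion
(`TorusCompositeCompanionSumG.compSumG_succ`, `rfl`) it is, storey by storey, the companion on `towerTorus Lc M j` conjugated by the composite sym rows of the
`c = n − j` storeys below it — all read on the SAME finest torus `towerTorus Lc M n` (the recursion's finest torus of the lower tower `towerTorus Lc (fine Lc M) (n−1)`
IS `towerTorus Lc M n` by `rfl`, which is why no closed form with casts is ever needed).  The one-storey packing (`TorusCompositeRowsSymSandwich`, g36 p408501: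
the engine p408072 at the rows' letters p408305) turns each storey's conjugate into `perF T (dper T 𝒦_j)`; THIS FILE adds the storeys up, generically: the
hypothesis is indexed by (storey `j`, co-depth `c`, `j + c = n`) so that its type at `j = 0` is the goal's and at `j + 1` is the induction hypothesis' — both by `rfl`.

WHAT ([folklore] induction on leaf-06's recursion + finite-sum ∕ `tsum` linearity; no `def`, no `def … : Prop`, nothing cited, 0 sorry):
* §1 **`compSumSym_eq_sum_perF_dper`** — for ANY torus-indexed companion family `G` and ANY storey kernels `𝒦 : ℕ → MKer (d+1) (Fin (d+1))`: if for every
  `j + c = n`, `(compRowsSym Lc (towerTorus Lc M j) (lev ∘ (· + j)) (rs ∘ (· + j)) c)ᵀ * G (towerTorus Lc M j) * (same rows) = perF (…) (dper (…) (𝒦 j))` on the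
  finest torus of that storey's sub-tower, then `compSumSym Lc G M lev rs n = Σ_{j < n} perF (towerTorus Lc M n) (dper (towerTorus Lc M n) (𝒦 j))` — NO
  summability letter (pure algebra); `compSumSym_onTowerFamily_eq_sum_perF_dper` — the same at leaf-06's NAMED family `G := onTowerFamily Lc M F` with the
  hypothesis read on the storey prescriptions `F j` (`onTowerFamily_towerTorus`, `2 ≤ Lc`).
* §2 **`perF_dper_finset_sum`** — `perF T (dper T (Σ_{j ∈ s} 𝒦 j)) = Σ_{j ∈ s} perF T (dper T (𝒦 j))` under the two pointwise summability letters of each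
  `𝒦 j` (diagonal `T`-translates; `T`-translates of `dper T (𝒦 j)`) — the engine's letters, storey by storey; and the assembled
  **`compSumSym_eq_perF_dper_sum`** ∕ **`compSumSym_onTowerFamily_eq_perF_dper_sum`**: `compSumSym … = perF T (dper T (Σ_{j<n} 𝒦 j))`.
WHAT THIS IS NOT: not the one-storey packing (p408501), not the storey cores ((B2)), not the row's contracted unrolling ((B4)); no row of the END wrapper
discharged; no estimate; nothing of Bałaban's asserted, valued or discharged; 0∕4 row-D1 binders (hW, hR, D1Tel, D1Rep); NOT (C1), NOT (T-ID), NOT SDF,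
NOT D1, NOT BetaPertH, NOT continuum, NOT Clay.  «not in print; our bookkeeping».

HONEST DEPENDENCY (page 1, mandatory): continuum YM on T⁴ ⇐ BetaPertH ∧ nine spine estimates (0/9 proved); BetaPertH ⇐ (D1) ∧ (D4) ∧ CAP+tail;
G-an2-4 gates asym, D1 and NE2/3/4.  HONEST FRAMING (cell contract, verbatim): «discharging `BetaPertH` makes Bałaban's UV stability UNCONDITIONAL —
a real constructive-QFT result; it is NOT the continuum limit and NOT the Clay problem.»  ABSOLUTE RULE (cell charter, verbatim): «No internally-minted
statement may enter as a cited fact. Every hypothesis is either kernel-proved in this package or a verbatim quotation of a PUBLISHED theorem with page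
reference. The manuscript(s) under audit are NOT citable for their own disputed steps — they are the thing under adjudication; programme-internal
(2001/route/tribunal) claims are never citable.»  Road «FP» OWNER, b2b-balaban-beta-d1-p3 gen 36, 2026-08-25.  No existing file touched.
-/

noncomputable section

open scoped BigOperators

namespace Summit.QuantumFields.BalabanUV.Beta.FP.TorusCompanionSumPeriodic

open Finset Matrix
open Literature.MathematicalPhysics.QuantumFieldTheory.Balaban1983to89
open Literature.MathematicalPhysics.QuantumFieldTheory.Balaban1983to89.Beta
open B4TorusKernel.MultiPeriod (translate)
open B5Prop11Plancherel (fine)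
open B6Lemma24Torus (pbox)
open ExpKernelCalculus (MKer)
open Summit.QuantumFields.BalabanUV.Beta.FP.KernelPeriodisationFib (Idx perF perF_apply perZ perZ_apply)
open Summit.QuantumFields.BalabanUV.Beta.FP.KernelPeriodisationFibLoc (dper dper_apply)
open Summit.QuantumFields.BalabanUV.Beta.FP.TorusCompositeObjects (towerTorus)
open Summit.QuantumFields.BalabanUV.Beta.FP.TorusCompositeObjectsG (compRowsSym)
open Summit.QuantumFields.BalabanUV.Beta.FP.TorusCompositeCompanionSumG (onTower compSumSym compSumSym_zero compSumSym_succ)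
open Summit.QuantumFields.BalabanUV.Beta.FP.TorusCompositeCompanionFamilyG (onTowerFamily onTowerFamily_towerTorus)

variable {d : ℕ} (Lc : ℕ) [NeZero Lc]

/-! ## §1 The companion sum, storey by storey periodised (pure algebra) -/

/-- [folklore] **`compSumSym_eq_sum_perF_dper` — THE COMPANION SUM IS THE SUM OF THE STOREYS' PERIODISATIONS**: for ANY torus-indexed family `G` and storey
kernels `𝒦 j`, if every storey `j` (co-depth `c`, `j + c = n`) has its conjugate by the composite sym rows below it equal to `perF (dper (𝒦 j))` on the finest
torus of its sub-tower, then `compSumSym Lc G M lev rs n = Σ_{j < n} perF (towerTorus Lc M n) (dper (towerTorus Lc M n) (𝒦 j))`.  Induction on leaf-06's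
push-inside recursion: the hypothesis at `j = 0` is the top term, at `j + 1` it is the induction hypothesis' — both by `rfl` on `towerTorus_succ` and `Nat.add`. -/
theorem compSumSym_eq_sum_perF_dper (G : (T : Fin (d + 1) → ℕ) → Matrix (↥(pbox T) × Fin (d + 1)) (↥(pbox T) × Fin (d + 1)) ℝ) :
    ∀ (n : ℕ) (M : Fin (d + 1) → ℕ) [∀ μ, NeZero (M μ)] (lev : ℕ → ℕ) (rs : ℕ → (Fin (d + 1) → ℕ)) (𝒦 : ℕ → MKer (d + 1) (Fin (d + 1)))
      (_ : ∀ j c : ℕ, j + c = n →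
        (compRowsSym Lc (towerTorus Lc M j) (fun i => lev (i + j)) (fun i => rs (i + j)) c)ᵀ * G (towerTorus Lc M j)
            * compRowsSym Lc (towerTorus Lc M j) (fun i => lev (i + j)) (fun i => rs (i + j)) c
          = perF (towerTorus Lc (towerTorus Lc M j) c) (dper (towerTorus Lc (towerTorus Lc M j) c) (𝒦 j))),
      compSumSym Lc G M lev rs n = ∑ j ∈ Finset.range n, perF (towerTorus Lc M n) (dper (towerTorus Lc M n) (𝒦 j))
  | 0, M, _, lev, rs, 𝒦, _ => by rw [compSumSym_zero, Finset.range_zero, Finset.sum_empty]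
  | n + 1, M, _, lev, rs, 𝒦, H => by
      have IH := compSumSym_eq_sum_perF_dper G n (fine Lc M) (fun k => lev (k + 1)) (fun k => rs (k + 1)) (fun j => 𝒦 (j + 1))
        (fun j c hjc => H (j + 1) c (by omega))
      have h0 : (compRowsSym Lc M lev rs (n + 1))ᵀ * G M * compRowsSym Lc M lev rs (n + 1)
          = perF (towerTorus Lc M (n + 1)) (dper (towerTorus Lc M (n + 1)) (𝒦 0)) := H 0 (n + 1) (by omega)
      rw [compSumSym_succ, h0, IH, Finset.sum_range_succ' (fun j => perF (towerTorus Lc M (n + 1)) (dper (towerTorus Lc M (n + 1)) (𝒦 j)))]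
      rfl

/-- [folklore] **THE SAME AT leaf-06's NAMED FAMILY `onTowerFamily Lc M F`** (`2 ≤ Lc`): the hypothesis is read on the storey PRESCRIPTIONS `F j`
(`onTowerFamily_towerTorus`), as the END wrapper's pin `hH₁f` displays them. -/
theorem compSumSym_onTowerFamily_eq_sum_perF_dper (hLc : 2 ≤ Lc) (n : ℕ) (M : Fin (d + 1) → ℕ) [∀ μ, NeZero (M μ)] (lev : ℕ → ℕ)
    (rs : ℕ → (Fin (d + 1) → ℕ)) (F : (k : ℕ) → Matrix (↥(pbox (towerTorus Lc M k)) × Fin (d + 1)) (↥(pbox (towerTorus Lc M k)) × Fin (d + 1)) ℝ)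
    (𝒦 : ℕ → MKer (d + 1) (Fin (d + 1)))
    (H : ∀ j c : ℕ, j + c = n →
      (compRowsSym Lc (towerTorus Lc M j) (fun i => lev (i + j)) (fun i => rs (i + j)) c)ᵀ * F j
          * compRowsSym Lc (towerTorus Lc M j) (fun i => lev (i + j)) (fun i => rs (i + j)) c
        = perF (towerTorus Lc (towerTorus Lc M j) c) (dper (towerTorus Lc (towerTorus Lc M j) c) (𝒦 j))) :
    compSumSym Lc (onTowerFamily Lc M F) M lev rs n = ∑ j ∈ Finset.range n, perF (towerTorus Lc M n) (dper (towerTorus Lc M n) (𝒦 j)) :=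
  compSumSym_eq_sum_perF_dper Lc (onTowerFamily Lc M F) n M lev rs 𝒦 fun j c hjc => by
    rw [onTowerFamily_towerTorus Lc hLc M F j]
    exact H j c hjc

/-! ## §2 Summing the storey kernels under their summability letters -/

section Additivity

variable (T : Fin (d + 1) → ℕ) {F : Type*}

omit [NeZero Lc] in
/-- [folklore] **`perZ_dper_finset_sum_apply`**: `perZ T (dper T (Σ_{j ∈ s} 𝒦 j)) x y a b = Σ_{j ∈ s} perZ T (dper T (𝒦 j)) x y a b` under the two pointwise
summability letters of each `𝒦 j` (`hSd`: diagonal `T`-translates; `hSp`: `T`-translates of `dper T (𝒦 j)`) — `Summable.tsum_finsetSum` twice. -/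
theorem perZ_dper_finset_sum_apply {ι : Type*} (s : Finset ι) (𝒦 : ι → MKer (d + 1) F)
    (hSd : ∀ j ∈ s, ∀ (x y : Fin (d + 1) → ℤ) (a b : F), Summable fun m₀ : Fin (d + 1) → ℤ => 𝒦 j (translate T x m₀) (translate T y m₀) a b)
    (hSp : ∀ j ∈ s, ∀ (x y : Fin (d + 1) → ℤ) (a b : F), Summable fun m : Fin (d + 1) → ℤ => dper T (𝒦 j) x (translate T y m) a b)
    (x y : Fin (d + 1) → ℤ) (a b : F) :
    perZ T (dper T (∑ j ∈ s, 𝒦 j)) x y a b = ∑ j ∈ s, perZ T (dper T (𝒦 j)) x y a b := by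
  have hd : ∀ x' y' : Fin (d + 1) → ℤ, dper T (∑ j ∈ s, 𝒦 j) x' y' a b = ∑ j ∈ s, dper T (𝒦 j) x' y' a b := fun x' y' => by
    simp only [dper_apply, Finset.sum_apply]
    exact Summable.tsum_finsetSum fun j hj => hSd j hj x' y' a b
  simp only [perZ_apply, hd]
  exact Summable.tsum_finsetSum fun j hj => hSp j hj x y a b

omit [NeZero Lc] in
/-- [folklore] **`perF_dper_finset_sum`** — matrix form: `perF T (dper T (Σ_{j ∈ s} 𝒦 j)) = Σ_{j ∈ s} perF T (dper T (𝒦 j))`. -/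
theorem perF_dper_finset_sum {ι : Type*} (s : Finset ι) (𝒦 : ι → MKer (d + 1) F)
    (hSd : ∀ j ∈ s, ∀ (x y : Fin (d + 1) → ℤ) (a b : F), Summable fun m₀ : Fin (d + 1) → ℤ => 𝒦 j (translate T x m₀) (translate T y m₀) a b)
    (hSp : ∀ j ∈ s, ∀ (x y : Fin (d + 1) → ℤ) (a b : F), Summable fun m : Fin (d + 1) → ℤ => dper T (𝒦 j) x (translate T y m) a b) :
    perF T (dper T (∑ j ∈ s, 𝒦 j)) = ∑ j ∈ s, perF T (dper T (𝒦 j)) := by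
  ext p q
  rw [perF_apply, perZ_dper_finset_sum_apply T s 𝒦 hSd hSp, Matrix.sum_apply]
  exact Finset.sum_congr rfl fun j _ => (perF_apply T _ p q).symm

end Additivity

/-- [folklore] **`compSumSym_eq_perF_dper_sum` — THE COMPANION SUM IS THE PERIODISATION OF THE SUM OF THE STOREY KERNELS**: §1 + §2
(`T := towerTorus Lc M n`; the letters `hSd ∕ hSp` storey by storey). -/
theorem compSumSym_eq_perF_dper_sum (G : (T : Fin (d + 1) → ℕ) → Matrix (↥(pbox T) × Fin (d + 1)) (↥(pbox T) × Fin (d + 1)) ℝ)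
    (n : ℕ) (M : Fin (d + 1) → ℕ) [∀ μ, NeZero (M μ)] (lev : ℕ → ℕ) (rs : ℕ → (Fin (d + 1) → ℕ)) (𝒦 : ℕ → MKer (d + 1) (Fin (d + 1)))
    (H : ∀ j c : ℕ, j + c = n →
      (compRowsSym Lc (towerTorus Lc M j) (fun i => lev (i + j)) (fun i => rs (i + j)) c)ᵀ * G (towerTorus Lc M j)
          * compRowsSym Lc (towerTorus Lc M j) (fun i => lev (i + j)) (fun i => rs (i + j)) c
        = perF (towerTorus Lc (towerTorus Lc M j) c) (dper (towerTorus Lc (towerTorus Lc M j) c) (𝒦 j)))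
    (hSd : ∀ j < n, ∀ (x y : Fin (d + 1) → ℤ) (a b : Fin (d + 1)),
      Summable fun m₀ : Fin (d + 1) → ℤ => 𝒦 j (translate (towerTorus Lc M n) x m₀) (translate (towerTorus Lc M n) y m₀) a b)
    (hSp : ∀ j < n, ∀ (x y : Fin (d + 1) → ℤ) (a b : Fin (d + 1)),
      Summable fun m : Fin (d + 1) → ℤ => dper (towerTorus Lc M n) (𝒦 j) x (translate (towerTorus Lc M n) y m) a b) :
    compSumSym Lc G M lev rs n = perF (towerTorus Lc M n) (dper (towerTorus Lc M n) (∑ j ∈ Finset.range n, 𝒦 j)) := by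
  rw [compSumSym_eq_sum_perF_dper Lc G n M lev rs 𝒦 H,
    perF_dper_finset_sum (towerTorus Lc M n) (Finset.range n) 𝒦 (fun j hj => hSd j (Finset.mem_range.1 hj)) (fun j hj => hSp j (Finset.mem_range.1 hj))]

/-- [folklore] **… AT THE NAMED FAMILY**: `compSumSym Lc (onTowerFamily Lc M F) M lev rs n = perF T (dper T (Σ_{j<n} 𝒦 j))` (`2 ≤ Lc`). -/
theorem compSumSym_onTowerFamily_eq_perF_dper_sum (hLc : 2 ≤ Lc) (n : ℕ) (M : Fin (d + 1) → ℕ) [∀ μ, NeZero (M μ)] (lev : ℕ → ℕ)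
    (rs : ℕ → (Fin (d + 1) → ℕ)) (F : (k : ℕ) → Matrix (↥(pbox (towerTorus Lc M k)) × Fin (d + 1)) (↥(pbox (towerTorus Lc M k)) × Fin (d + 1)) ℝ)
    (𝒦 : ℕ → MKer (d + 1) (Fin (d + 1)))
    (H : ∀ j c : ℕ, j + c = n →
      (compRowsSym Lc (towerTorus Lc M j) (fun i => lev (i + j)) (fun i => rs (i + j)) c)ᵀ * F j
          * compRowsSym Lc (towerTorus Lc M j) (fun i => lev (i + j)) (fun i => rs (i + j)) c
        = perF (towerTorus Lc (towerTorus Lc M j) c) (dper (towerTorus Lc (towerTorus Lc M j) c) (𝒦 j)))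
    (hSd : ∀ j < n, ∀ (x y : Fin (d + 1) → ℤ) (a b : Fin (d + 1)),
      Summable fun m₀ : Fin (d + 1) → ℤ => 𝒦 j (translate (towerTorus Lc M n) x m₀) (translate (towerTorus Lc M n) y m₀) a b)
    (hSp : ∀ j < n, ∀ (x y : Fin (d + 1) → ℤ) (a b : Fin (d + 1)),
      Summable fun m : Fin (d + 1) → ℤ => dper (towerTorus Lc M n) (𝒦 j) x (translate (towerTorus Lc M n) y m) a b) :
    compSumSym Lc (onTowerFamily Lc M F) M lev rs n = perF (towerTorus Lc M n) (dper (towerTorus Lc M n) (∑ j ∈ Finset.range n, 𝒦 j)) := by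
  rw [compSumSym_onTowerFamily_eq_sum_perF_dper Lc hLc n M lev rs F 𝒦 H,
    perF_dper_finset_sum (towerTorus Lc M n) (Finset.range n) 𝒦 (fun j hj => hSd j (Finset.mem_range.1 hj)) (fun j hj => hSp j (Finset.mem_range.1 hj))]

end Summit.QuantumFields.BalabanUV.Beta.FP.TorusCompanionSumPeriodic

end
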